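import Literature.NumberTheory.Automorphic.AdelicPiSchwartzBruhatFourier      -- ★ character at ∞, `tracePairing`, adele instances (transitively `AdelicAdditiveCharacterDuality`)
import Literature.NumberTheory.Automorphic.AdeleRingTopology                   -- ★ `infiniteAdeleRingHomeomorph : K_∞ ≃ₜ mixedSpace K`
import Literature.Analysis.Distribution.SchwartzFourierBilinForm               -- ★ `exists_continuousLinearEquiv_bilinForm_eq_inner`
import Literature.NumberTheory.Automorphic.ArchimedeanDetIntegral              -- ★ `one_add_pow_le_two_pow_mul`
import Mathlib.Analysis.Fourier.FourierTransformDeriv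
import HarnessLib

/-!
# h413 ∕ Track B «K2-LIT», page EIS-RANK-ONE, rung R6d — `K2E1InfiniteAdeleFourierDecay` (D1-b′): `C^n` WITH INTEGRABLE DERIVATIVES ⟹ FOURIER DECAY OF ORDER `n`,
# for a non-degenerate pairing on a finite-dimensional real space, and on `K_∞` for Tate's character — the calculus lemma turning the archimedean smoothness binder into (iii″)

Cell `pub/hodgecm-mathlib`, crux H413 = `stmt-HodgeConjecture-24833` (supports-only helper, count-neutral), route `HCCMUnconditional`; dealer K2E1-plan (g3), ruling
«R6d-FIBREWISE» (2) 2026-09-04T05:44:38Z («(iii″) from `hφ∞` + p10's (D1-b′)») → K2E4-p10 (g3).  THEOREMS ONLY (no `def`, no `instance`, no `notation`, no named-fact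
hypothesis, no `sorry`).

## Statements

* §1 (GENERIC) `exists_forall_one_add_norm_pow_mul_norm_fourier_le`: for a finite-dimensional real normed space `V` with additive Haar measure `μ`, a NON-DEGENERATE bilinear
  form `B` and `n : ℕ` there is `C ≥ 0` (depending on `B`, `n` only) with
  `(1 + ‖w‖)^n · ‖∫ f(v) 𝐞(−B(v, w)) dμ(v)‖ ≤ C · Σ_{j ≤ n} ∫ ‖D^j f‖ dμ` for every `f : V → ℂ` of class `C^n` whose derivatives of order `≤ n` are integrable, and every `w`.
  (Mathlib `VectorFourier.pow_mul_norm_iteratedFDeriv_fourierIntegral_le` — integration by parts `n` times — plus quantitative non-degeneracy from ★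
  `exists_continuousLinearEquiv_bilinForm_eq_inner`: `B(v, w) = ⟪T v, S w⟫`.)
* §2 (THE BRIDGE TO `K_∞`) `exists_forall_norm_integral_mul_adeleAddChar_le`: on `K_∞ = InfiniteAdeleRing K` with Tate's character `ψ((y a, 0)) = 𝐞(−Tr(y a))`
  (★ `adeleAddChar_infiniteAdeleInl`, ★ `mixedTrace_ringEquiv_mixedSpace`), read through Mathlib's `ringEquiv_mixedSpace` (★ `infiniteAdeleRingHomeomorph`): for
  `g := Φ₁ ∘ ringEquiv⁻¹` of class `C^n` with `μ₁`-integrable derivatives, `‖∫ Φ₁(a) ψ((y a, 0)) dμ₁(a)‖ ≤ (C · Σ_{j ≤ n} ‖D^j g‖₁) · (1 + ‖ringEquiv y‖)^{−n}` — EXACTLY the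
  fibrewise binder (iii″) of ★ `K2E1AdelicFourierEnvelope.exists_envelope` with `A b := C · Σ_j ‖D^j g_b‖₁`.

HONEST LABEL.  Count-neutral helper; proves no printed statement; HC_CM is proved only modulo the 7 printed citations (2 remaining named inputs: hLiu418 =
`stmt-HodgeConjecture-24832`, h413 = `stmt-HodgeConjecture-24833`) until rung 0 closes.

## References
* [CasselsFrohlichANT1967] J. Tate, *Fourier analysis in number fields and Hecke's zeta-functions*, Ch. XV of Cassels–Fröhlich (1967), §2.2 (the self-dual `ψ_v` and
  `Tr`), §3.2 (archimedean standard functions).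
* [MoeglinWaldspurger1995] C. Mœglin, J.-L. Waldspurger, *Spectral decomposition and Eisenstein series* (1995), I.2.10–I.2.11, II.1.10 (rapid decay of Fourier terms).
* L. Hörmander, *The Analysis of Linear Partial Differential Operators I*, Lemma 7.1.3 (`|ξ^α 𝓕f| ≤ ‖D^α f‖_{L¹}`) [folklore].
-/

set_option autoImplicit false
set_option linter.dupNamespace false  -- the mandated namespace repeats the summit's segment (`HodgeConjecture.HodgeConjecture`)

noncomputable section

open scoped NNReal ENNReal Classical FourierTransform RealInnerProductSpace
open MeasureTheory MeasureTheory.Measure Real NumberField NumberField.mixedEmbedding IsDedekindDomain Set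
open Literature.NumberTheory.Automorphic Literature.Analysis.Distribution

namespace Summit.HodgeConjecture.HodgeConjecture.Cruxes.H413.K2E1InfiniteAdeleFourierDecay

/-! ## §1 Generic: `C^n` with integrable derivatives ⟹ decay of order `n` of the Fourier integral for a non-degenerate pairing -/

section Generic

variable {V : Type*} [NormedAddCommGroup V] [NormedSpace ℝ V] [FiniteDimensional ℝ V] [MeasurableSpace V] [BorelSpace V]

/-- **`C^n` WITH INTEGRABLE DERIVATIVES ⟹ FOURIER DECAY OF ORDER `n`** (see the module docstring): one constant `C ≥ 0`, depending on the non-degenerate pairing `B` and on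
`n` only, such that `(1 + ‖w‖)^n ‖∫ f(v) 𝐞(−B(v,w)) dμ(v)‖ ≤ C Σ_{j ≤ n} ∫ ‖D^j f‖ dμ` for all admissible `f` and all `w`. [cite: CasselsFrohlichANT1967, Ch. XV §3.2]
[cite: MoeglinWaldspurger1995, I.2.10] -/
theorem exists_forall_one_add_norm_pow_mul_norm_fourier_le (μ : Measure V) [μ.IsAddHaarMeasure] (B : LinearMap.BilinForm ℝ V) (hB : B.Nondegenerate) (n : ℕ) :
    ∃ C : ℝ, 0 ≤ C ∧ ∀ f : V → ℂ, ContDiff ℝ n f → (∀ j : ℕ, j ≤ n → Integrable (iteratedFDeriv ℝ j f) μ) →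
      ∀ w : V, (1 + ‖w‖) ^ n * ‖∫ v, f v * (𝐞 (-(B v w)) : ℂ) ∂μ‖ ≤ C * ∑ j ∈ Finset.range (n + 1), ∫ v, ‖iteratedFDeriv ℝ j f v‖ ∂μ := by
  -- `B` as a continuous bilinear map
  let L : V →L[ℝ] V →L[ℝ] ℝ :=
    LinearMap.toContinuousLinearMap (((LinearMap.toContinuousLinearMap : (V →ₗ[ℝ] ℝ) ≃ₗ[ℝ] (V →L[ℝ] ℝ)) : (V →ₗ[ℝ] ℝ) →ₗ[ℝ] (V →L[ℝ] ℝ)) ∘ₗ B)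
  have hL : ∀ v w, L v w = B v w := fun v w => rfl
  -- quantitative non-degeneracy: `B v w = ⟪T v, S w⟫`
  obtain ⟨T, S, hTS⟩ := exists_continuousLinearEquiv_bilinForm_eq_inner B hB
  set a : ℝ := ‖(T.symm : EuclideanSpace ℝ (Fin (Module.finrank ℝ V)) →L[ℝ] V)‖ with ha
  set b : ℝ := ‖(S.symm : EuclideanSpace ℝ (Fin (Module.finrank ℝ V)) →L[ℝ] V)‖ with hb
  refine ⟨2 ^ n * (1 + (2 * a * b) ^ n), by positivity, ?_⟩
  intro f hf hint w
  set D : ℝ := ∑ j ∈ Finset.range (n + 1), ∫ v, ‖iteratedFDeriv ℝ j f v‖ ∂μ with hD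
  have hD0 : 0 ≤ D := Finset.sum_nonneg fun j _ => integral_nonneg fun v => norm_nonneg _
  -- the Fourier integral in Mathlib's currency
  have hFI : ∫ v, f v * (𝐞 (-(B v w)) : ℂ) ∂μ = VectorFourier.fourierIntegral 𝐞 μ L.toLinearMap₁₂ f w := by
    rw [VectorFourier.fourierIntegral]
    refine integral_congr_ae (Filter.Eventually.of_forall fun v => ?_)
    change f v * (𝐞 (-(B v w)) : ℂ) = ((𝐞 (-(B v w))) : ℂ) * f v
    exact mul_comm _ _
  -- Mathlib's integration by parts, `k = 0`
  have h'f : ∀ (k m : ℕ), (k : ℕ∞) ≤ (0 : ℕ) → (m : ℕ∞) ≤ (n : ℕ) → Integrable (fun v => ‖v‖ ^ k * ‖iteratedFDeriv ℝ m f v‖) μ := by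
    intro k m hk hm
    have hk0 : k = 0 := Nat.le_zero.1 (by exact_mod_cast hk)
    subst hk0
    simpa only [pow_zero, one_mul] using (hint m (by exact_mod_cast hm)).norm
  have key : ∀ (m : ℕ), m ≤ n → ∀ v : V, |B v w| ^ m * ‖∫ v, f v * (𝐞 (-(B v w)) : ℂ) ∂μ‖ ≤ ‖v‖ ^ m * 2 ^ m * D := by
    intro m hm v
    have h := VectorFourier.pow_mul_norm_iteratedFDeriv_fourierIntegral_le L (K := (0 : ℕ)) (N := (n : ℕ)) hf h'f (k := 0) (n := m) le_rfl
      (by exact_mod_cast hm) v w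
    rw [norm_iteratedFDeriv_zero, ← hFI, hL] at h
    refine h.trans ?_
    have hsum : ∑ p ∈ Finset.range (0 + 1) ×ˢ Finset.range (m + 1), ∫ v, ‖v‖ ^ p.1 * ‖iteratedFDeriv ℝ p.2 f v‖ ∂μ ≤ D := by
      rw [Finset.sum_product, zero_add, Finset.range_one, Finset.sum_singleton]
      simp only [pow_zero, one_mul]
      exact Finset.sum_le_sum_of_subset_of_nonneg (Finset.range_mono (by omega)) fun j _ _ => integral_nonneg fun v => norm_nonneg _
    calc ‖v‖ ^ m * (2 * π * ‖L‖) ^ 0 * (2 * (0 : ℕ) + 2 : ℝ) ^ m * ∑ p ∈ Finset.range (0 + 1) ×ˢ Finset.range (m + 1), ∫ v, ‖v‖ ^ p.1 * ‖iteratedFDeriv ℝ p.2 f v‖ ∂μ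
        ≤ ‖v‖ ^ m * (2 * π * ‖L‖) ^ 0 * (2 * (0 : ℕ) + 2 : ℝ) ^ m * D := mul_le_mul_of_nonneg_left hsum (by positivity)
      _ = ‖v‖ ^ m * 2 ^ m * D := by norm_num
  set Fw : ℝ := ‖∫ v, f v * (𝐞 (-(B v w)) : ℂ) ∂μ‖ with hFw
  have hF0 : 0 ≤ Fw := norm_nonneg _
  have ha0 : 0 ≤ a := norm_nonneg _
  have hb0 : 0 ≤ b := norm_nonneg _
  -- order `0`: `‖𝓕 f(w)‖ ≤ D`
  have h0 : Fw ≤ D := by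
    have h := key 0 (Nat.zero_le n) 0
    simpa only [pow_zero, one_mul] using h
  -- order `n`: `‖w‖^n ‖𝓕 f(w)‖ ≤ (2ab)^n D`, testing against `v₀ = T⁻¹ (S w)`
  have hn : ‖w‖ ^ n * Fw ≤ (2 * a * b) ^ n * D := by
    set s : ℝ := ‖S w‖ with hs
    have hsw : ‖w‖ ≤ b * s := by
      have h := (S.symm : EuclideanSpace ℝ (Fin (Module.finrank ℝ V)) →L[ℝ] V).le_opNorm (S w)
      rwa [ContinuousLinearEquiv.coe_coe, ContinuousLinearEquiv.symm_apply_apply] at h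
    rcases eq_or_lt_of_le (norm_nonneg (S w)) with hs0 | hs0
    · -- `S w = 0`, so `w = 0`
      have hw0 : ‖w‖ = 0 := by
        have h : ‖w‖ ≤ b * s := hsw
        rw [hs, ← hs0, mul_zero] at h
        exact le_antisymm h (norm_nonneg _)
      rcases Nat.eq_zero_or_pos n with hn0 | hn0
      · subst hn0; simpa only [pow_zero, one_mul] using h0
      · rw [hw0, zero_pow hn0.ne', zero_mul]; positivity
    · have hv₀ : ‖T.symm (S w)‖ ≤ a * s := by
        have h := (T.symm : EuclideanSpace ℝ (Fin (Module.finrank ℝ V)) →L[ℝ] V).le_opNorm (S w)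
        rwa [ContinuousLinearEquiv.coe_coe] at h
      have hB₀ : B (T.symm (S w)) w = s ^ 2 := by
        rw [hTS, ContinuousLinearEquiv.apply_symm_apply, real_inner_self_eq_norm_sq]
      have h := key n le_rfl (T.symm (S w))
      rw [hB₀, abs_of_nonneg (sq_nonneg s), ← pow_mul] at h
      -- `s^(2n) Fw ≤ (a s)^n 2^n D`, divide by `s^n`
      have h2 : s ^ (2 * n) * Fw ≤ (a * s) ^ n * 2 ^ n * D :=
        h.trans (mul_le_mul_of_nonneg_right (mul_le_mul_of_nonneg_right (pow_le_pow_left₀ (norm_nonneg _) hv₀ n) (by positivity)) hD0)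
      have hsn : 0 < s ^ n := pow_pos hs0 n
      have h3 : s ^ n * Fw ≤ (2 * a) ^ n * D := by
        have h4 : s ^ n * (s ^ n * Fw) ≤ s ^ n * ((2 * a) ^ n * D) := by
          calc s ^ n * (s ^ n * Fw) = s ^ (2 * n) * Fw := by ring
            _ ≤ (a * s) ^ n * 2 ^ n * D := h2
            _ = s ^ n * ((2 * a) ^ n * D) := by ring
        exact le_of_mul_le_mul_left h4 hsn
      calc ‖w‖ ^ n * Fw ≤ (b * s) ^ n * Fw := mul_le_mul_of_nonneg_right (pow_le_pow_left₀ (norm_nonneg _) hsw n) hF0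
        _ = b ^ n * (s ^ n * Fw) := by ring
        _ ≤ b ^ n * ((2 * a) ^ n * D) := mul_le_mul_of_nonneg_left h3 (by positivity)
        _ = (2 * a * b) ^ n * D := by ring
  -- assemble with `(1 + t)^n ≤ 2^n (1 + t^n)`
  calc (1 + ‖w‖) ^ n * Fw ≤ 2 ^ n * (1 + ‖w‖ ^ n) * Fw := mul_le_mul_of_nonneg_right (one_add_pow_le_two_pow_mul ‖w‖ (norm_nonneg _) n) hF0
    _ = 2 ^ n * (Fw + ‖w‖ ^ n * Fw) := by ring
    _ ≤ 2 ^ n * (D + (2 * a * b) ^ n * D) := mul_le_mul_of_nonneg_left (add_le_add h0 hn) (by positivity)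
    _ = 2 ^ n * (1 + (2 * a * b) ^ n) * D := by ring

end Generic

/-! ## §2 The bridge to `K_∞` and Tate's character -/

section InfiniteAdele

variable (K : Type) [Field K] [NumberField K] [MeasurableSpace (InfiniteAdeleRing K)] [BorelSpace (InfiniteAdeleRing K)]

omit [MeasurableSpace (InfiniteAdeleRing K)] [BorelSpace (InfiniteAdeleRing K)] in
/-- `ψ((y a, 0)) = 𝐞(−⟨ringEquiv a, ringEquiv y⟩_{Tr})`: Tate's character at the infinite places is the exponential of minus the trace pairing of the mixed-space coordinates
(★ `adeleAddChar_infiniteAdeleInl`, ★ `mixedTrace_ringEquiv_mixedSpace`). [cite: CasselsFrohlichANT1967, Ch. XV §2.2] -/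
theorem adeleAddChar_infiniteAdeleInl_mul (y a : InfiniteAdeleRing K) :
    (adeleAddChar K (infiniteAdeleInl K (y * a)) : ℂ) =
      𝐞 (-(tracePairing K (InfiniteAdeleRing.ringEquiv_mixedSpace K a) (InfiniteAdeleRing.ringEquiv_mixedSpace K y))) := by
  rw [adeleAddChar_infiniteAdeleInl, tracePairing_apply, ← map_mul, mixedTrace_ringEquiv_mixedSpace, mul_comm]

/-- **THE ARCHIMEDEAN DECAY BINDER (iii″) FROM SMOOTHNESS** (see the module docstring): for an additive Haar `μ₁` on `K_∞` and `n : ℕ` there is `C ≥ 0` such that for every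
`Φ₁ : K_∞ → ℂ` whose mixed-space reading `g = Φ₁ ∘ ringEquiv⁻¹` is `C^n` with derivatives of order `≤ n` integrable for `ringEquiv_* μ₁`, and every `y ∈ K_∞`,
`‖∫ Φ₁(a) ψ((y a, 0)) dμ₁(a)‖ ≤ (C Σ_{j ≤ n} ‖D^j g‖₁) (1 + ‖ringEquiv y‖)^{−n}` — the fibre bound of ★ `K2E1AdelicFourierEnvelope.exists_envelope` with `A b := C Σ_j ‖D^j g_b‖₁`.
[cite: CasselsFrohlichANT1967, Ch. XV §3.2] [cite: MoeglinWaldspurger1995, II.1.10] -/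
theorem exists_forall_norm_integral_mul_adeleAddChar_le (μ₁ : Measure (InfiniteAdeleRing K)) [μ₁.IsAddHaarMeasure] (n : ℕ) :
    ∃ C : ℝ, 0 ≤ C ∧ ∀ Φ₁ : InfiniteAdeleRing K → ℂ,
      ContDiff ℝ n (Φ₁ ∘ (InfiniteAdeleRing.ringEquiv_mixedSpace K).symm) →
      (∀ j : ℕ, j ≤ n → Integrable (iteratedFDeriv ℝ j (Φ₁ ∘ (InfiniteAdeleRing.ringEquiv_mixedSpace K).symm)) (μ₁.map (InfiniteAdeleRing.ringEquiv_mixedSpace K))) →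
      ∀ y : InfiniteAdeleRing K,
        ‖∫ a, Φ₁ a * (adeleAddChar K (infiniteAdeleInl K (y * a)) : ℂ) ∂μ₁‖ ≤
          (C * ∑ j ∈ Finset.range (n + 1), ∫ x, ‖iteratedFDeriv ℝ j (Φ₁ ∘ (InfiniteAdeleRing.ringEquiv_mixedSpace K).symm) x‖ ∂(μ₁.map (InfiniteAdeleRing.ringEquiv_mixedSpace K))) *
            (1 + ‖InfiniteAdeleRing.ringEquiv_mixedSpace K y‖) ^ (-(n : ℝ)) := by
  -- `ringEquiv_* μ₁` is an additive Haar measure on the mixed space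
  have hme : MeasurableEmbedding (InfiniteAdeleRing.ringEquiv_mixedSpace K) := by
    rw [← coe_infiniteAdeleRingHomeomorph]
    exact (infiniteAdeleRingHomeomorph K).measurableEmbedding
  haveI : (μ₁.map (InfiniteAdeleRing.ringEquiv_mixedSpace K)).IsAddHaarMeasure :=
    AddEquiv.isAddHaarMeasure_map μ₁ (InfiniteAdeleRing.ringEquiv_mixedSpace K).toAddEquiv (continuous_ringEquiv_mixedSpace K)
      (continuous_ringEquiv_mixedSpace_symm K)
  obtain ⟨C, hC0, hC⟩ := exists_forall_one_add_norm_pow_mul_norm_fourier_le (μ₁.map (InfiniteAdeleRing.ringEquiv_mixedSpace K)) (tracePairing K)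
    (tracePairing_nondegenerate K) n
  refine ⟨C, hC0, fun Φ₁ hg hgi y => ?_⟩
  set g : mixedSpace K → ℂ := Φ₁ ∘ (InfiniteAdeleRing.ringEquiv_mixedSpace K).symm with hgdef
  set w : mixedSpace K := InfiniteAdeleRing.ringEquiv_mixedSpace K y with hw
  -- the integral, read on the mixed space
  have hI : ∫ a, Φ₁ a * (adeleAddChar K (infiniteAdeleInl K (y * a)) : ℂ) ∂μ₁ =
      ∫ x, g x * (𝐞 (-(tracePairing K x w)) : ℂ) ∂(μ₁.map (InfiniteAdeleRing.ringEquiv_mixedSpace K)) := by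
    rw [hme.integral_map]
    refine integral_congr_ae (Filter.Eventually.of_forall fun a => ?_)
    simp only [hgdef, Function.comp_apply, RingEquiv.symm_apply_apply, adeleAddChar_infiniteAdeleInl_mul, hw]
  have hmain := hC g hg hgi w
  rw [← hI] at hmain
  set D : ℝ := ∑ j ∈ Finset.range (n + 1), ∫ x, ‖iteratedFDeriv ℝ j g x‖ ∂(μ₁.map (InfiniteAdeleRing.ringEquiv_mixedSpace K)) with hD
  have hpos : 0 < (1 + ‖w‖) ^ n := pow_pos (by positivity) n
  have hrpow : (1 + ‖w‖) ^ (-(n : ℝ)) = ((1 + ‖w‖) ^ n)⁻¹ := by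
    rw [Real.rpow_neg (by positivity), Real.rpow_natCast]
  rw [hrpow, ← div_eq_mul_inv, le_div_iff₀ hpos, mul_comm]
  exact hmain

end InfiniteAdele

end Summit.HodgeConjecture.HodgeConjecture.Cruxes.H413.K2E1InfiniteAdeleFourierDecay

end
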